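import Summits.CriticalPhenomena.PercolationContinuityZ3.Theorems.PercAnnulusCrossingIICAtomsLowerTransfer
import Summits.CriticalPhenomena.PercolationContinuityZ3.Theorems.PercAnnulusCrossingIICTwoPointLower
import HarnessLib

/-!
# The multipoint function of Kesten's IIC across separated scales is at least `c^k ∏ π(‖z_i‖)` (lane RSW3, p1 gen 19)

builds on p205010 (kernel theorem, internal audit signed; external expert review pending) — NOT used in this file (only `p_c(ℤ^d) > 0`).

RSW3 lane (LANE 3 `prim-rsw3`), seat `prim-rsw3-p1` (gen 19).  Helper file (`--supports stmt-CriticalPhenomena-4575`);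
no definitions, no sorries.  Memo `run/shared/lean/prim/rsw3/P1-QM.md` §32.

Iterating the sharp quenched two-point bound of gen 19 (6) (`(c_U/2B_l)·π(64u)·ν(H) ≤ ν(H ∩ {0 ↔ z in Λ(64lu)})` for every
cluster-saturated inside event `H` at scale `b`, `u = sKb`) along the geometric scales `b_{i+1} = 64 l sK · b_i`, with one site `z_i` in each
shell `Λ(64u_i) ∖ Λ(32u_i)`:

* **`prod_mul_iicMeasure_le_biInter_openConnIn`** — every `d`, `p` (hypotheses of gen 18 (13)): for every finite measure `ν` with Kesten's IIC
  limit property and every `k`: **`∏_{i<k} ((c_U/2B_l)·π_p(64u_i)) · ν(univ) ≤ ν(⋂_{i<k} {0 ↔ z_i in Λ(b_k)})`**;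
* **`exists_prod_oneArmProb_le_iicMeasure_biInter_openConn_criticalProbI`** — at `p_c(ℤ^d)`, `d ≥ 2`, under (A2)□(s,L) + `CU⁺_l` + UAD: there are
  `v ≥ 1` and `c > 0` such that for every IIC measure `ν`, every `b₀ ≥ 1`, every `k` and all sites `z_i` with `32·v·b₀ρ^i < ‖z_i‖_∞ ≤ 64·v·b₀ρ^i`
  (`ρ = 64 l v`): **`c^k · ∏_{i<k} π_{p_c}(‖z_i‖_∞) ≤ ν(z_0, …, z_{k−1} ∈ C(0))`** — k POINTS AT GEOMETRICALLY SEPARATED SCALES BELONG TO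
  THE IIC WITH PROBABILITY AT LEAST `c^k` TIMES THE PRODUCT OF THEIR ONE-ARM PROBABILITIES: the lower half of
  `ν(z_0,…,z_{k−1} ∈ C(0)) ≍ ∏ π(‖z_i‖)` (the upper half is p2's tree bound `Rsw3.iicMeasure_real_iInter_openConn_le`).
References: H. Kesten, Probab. Theory Relat. Fields 73 (1986), Thm. (8); D. Basu, A. Sapozhnikov, ECP 22 (2017).
-/

noncomputable section

namespace Summit.CriticalPhenomena.PercolationContinuityZ3.Theorems.Crossing

open MeasureTheory Filter Topology Literature.Probability.Percolation Literature.Probability.LatticeModels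
open Literature.Probability.Percolation.DCT16
open Summit.CriticalPhenomena.PercolationContinuityZ3.Theorems.SurfaceTension

variable {d : ℕ}

/-- **THE MULTIPOINT LOWER BOUND ACROSS GEOMETRIC SCALES** (every `d`, `p`; hypotheses of gen 18 (13): `CU⁺_l(c_U)`, `l ≥ 2`, annulus decay
`α(m,N) ≤ ε` for `N ≥ K₀m` with `εB_l ≤ 1/2`, ratio bound `π(j) ≤ B_lπ(m)` for `j ≤ m ≤ 4(l+1)j`, `s ≥ 2`, `K ≥ 1`, `K₀ ≤ 16sK`; scales `b_0 ≥ 1`,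
`b_{i+1} = l·64·sK·b_i`; sites `z_i ∈ Λ(64sKb_i) ∖ Λ(32sKb_i)`): for every finite measure `ν` with Kesten's IIC limit property and every `k`:
**`(∏_{i<k} (c_U/2B_l)·π_p(64sKb_i)) · ν(univ) ≤ ν(⋂_{i<k} {0 ↔ z_i in Λ(b_k)})`**.  Induction on `k`: the event at step `k` reads only the
cluster of `0` inside `Λ(b_k)`, so gen 19 (6) adds `z_k` at the sharp rate; boxes grow along the way. [cite: Kesten1986, Thm. (8)] -/
theorem prod_mul_iicMeasure_le_biInter_openConnIn (p : unitInterval) {l : ℕ} (hl : 2 ≤ l) {cU : ℝ} (hcU : 0 ≤ cU)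
    (hCU : ∀ a : ℕ, 1 ≤ a → ∀ E : Set (BondConfig (Site d)), IsUpperSet E → MeasurableSet E →
      cU * (bondPercolation (zdGraph d) p).real E ≤ (bondPercolation (zdGraph d) p).real (E ∩
        {ω : BondConfig (Site d) | ∀ t ∈ innerBoundary (zdGraph d) (box d a), ∀ s ∈ innerBoundary (zdGraph d) (box d (l * a)),
          ∀ t' ∈ innerBoundary (zdGraph d) (box d a), ∀ s' ∈ innerBoundary (zdGraph d) (box d (l * a)),
          ω ∈ openConnIn (↑((box d (l * a) \ box d a) ∪ innerBoundary (zdGraph d) (box d a)) : Set (Site d)) t s →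
          ω ∈ openConnIn (↑((box d (l * a) \ box d a) ∪ innerBoundary (zdGraph d) (box d a)) : Set (Site d)) t' s' →
          ω ∈ openConnIn (↑((box d (l * a) \ box d a) ∪ innerBoundary (zdGraph d) (box d a)) : Set (Site d)) s s'}))
    {ε Bl : ℝ} (hBl : 0 < Bl) (hεB : ε * Bl ≤ 1 / 2) {K₀ : ℕ}
    (hUAD : ∀ m : ℕ, 1 ≤ m → ∀ N : ℕ, K₀ * m ≤ N → (bondPercolation (zdGraph d) p).real (boxCrossing d m N) ≤ ε)
    (hRl : ∀ j m : ℕ, 1 ≤ j → j ≤ m → m ≤ 4 * (l + 1) * j → oneArmProb d p j ≤ Bl * oneArmProb d p m)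
    {ν : Measure (BondConfig (Site d))} [IsFiniteMeasure ν]
    (hν : ∀ (F : Finset (Sym2 (Site d))) (E : Set (BondConfig (Site d))), MeasurableSet E → DeterminedBy E ↑F →
      Tendsto (fun n : ℕ => (bondPercolation (zdGraph d) p).real (E ∩ siteToBoundary d n) / oneArmProb d p n)
        atTop (𝓝 (ν.real E)))
    {s K : ℕ} (hs : 2 ≤ s) (hK : 1 ≤ K) (hK₀ : K₀ ≤ 16 * s * K)
    (b : ℕ → ℕ) (hb0 : 1 ≤ b 0) (hb : ∀ i, b (i + 1) = l * (64 * (s * K * b i)))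
    (z : ℕ → Site d) (hz : ∀ i, z i ∈ box d (64 * (s * K * b i)) \ box d (32 * (s * K * b i))) (k : ℕ) :
    (∏ i ∈ Finset.range k, cU / (2 * Bl) * oneArmProb d p (64 * (s * K * b i))) * ν.real Set.univ ≤
      ν.real (⋂ i ∈ Finset.range k, openConnIn (↑(box d (b k)) : Set (Site d)) 0 (z i)) := by
  have hb1 : ∀ i, 1 ≤ b i := by
    intro i
    induction i with
    | zero => exact hb0
    | succ i ih =>
      rw [hb i]
      have : 1 ≤ s * K * b i := Nat.one_le_iff_ne_zero.2 (by positivity)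
      nlinarith
  have hbmono : ∀ i, b i ≤ b (i + 1) := by
    intro i
    rw [hb i]
    have h1 : b i ≤ s * K * b i := Nat.le_mul_of_pos_left _ (by positivity)
    have h3 : 64 * (s * K * b i) ≤ l * (64 * (s * K * b i)) := Nat.le_mul_of_pos_left _ (by omega)
    omega
  induction k with
  | zero => simp
  | succ k ih =>
    -- the event at step `k` reads only the cluster of `0` inside `Λ(b_k)`
    set H : Set (BondConfig (Site d)) := ⋂ i ∈ Finset.range k, openConnIn (↑(box d (b k)) : Set (Site d)) 0 (z i) with hH
    have hHl : IsLocalEvent H :=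
      ⟨(box d (b k)).sym2, DeterminedBy.iInter fun i => DeterminedBy.iInter fun _ => determinedBy_openConnIn _ 0 (z i) (by rw [Finset.coe_sym2])⟩
    have hstep := mul_iicMeasure_real_inter_openConnIn_le_of_saturated p hl hcU hCU hBl hεB hUAD hRl hν hs hK hK₀ (hb1 k) hHl
      (biInter_openConnIn_saturated (b k) (Finset.range k) z) (hz k)
    have hθ : 0 ≤ cU / (2 * Bl) * oneArmProb d p (64 * (s * K * b k)) :=
      mul_nonneg (div_nonneg hcU (by positivity)) (by unfold oneArmProb; exact measureReal_nonneg)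
    -- boxes grow: `H ∩ {0 ↔ z_k in Λ(b_{k+1})} ⊆ ⋂_{i<k+1} {0 ↔ z_i in Λ(b_{k+1})}`
    have hsub : H ∩ openConnIn (↑(box d (l * (64 * (s * K * b k)))) : Set (Site d)) 0 (z k) ⊆
        ⋂ i ∈ Finset.range (k + 1), openConnIn (↑(box d (b (k + 1))) : Set (Site d)) 0 (z i) := by
      rintro ω ⟨hωH, hωk⟩
      rw [Finset.range_add_one, Finset.set_biInter_insert]
      refine ⟨by rw [hb k]; exact hωk, ?_⟩
      rw [hH] at hωH
      exact Set.biInter_mono (fun i hi => hi)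
        (fun i _ => openConnIn_mono (Finset.coe_subset.2 (box_mono d (hbmono k))) (0 : Site d) (z i)) hωH
    rw [Finset.prod_range_succ]
    calc (∏ i ∈ Finset.range k, cU / (2 * Bl) * oneArmProb d p (64 * (s * K * b i))) *
          (cU / (2 * Bl) * oneArmProb d p (64 * (s * K * b k))) * ν.real Set.univ
        = cU / (2 * Bl) * oneArmProb d p (64 * (s * K * b k)) *
            ((∏ i ∈ Finset.range k, cU / (2 * Bl) * oneArmProb d p (64 * (s * K * b i))) * ν.real Set.univ) := by ring
      _ ≤ cU / (2 * Bl) * oneArmProb d p (64 * (s * K * b k)) * ν.real H := mul_le_mul_of_nonneg_left ih hθ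
      _ ≤ ν.real (H ∩ openConnIn (↑(box d (l * (64 * (s * K * b k)))) : Set (Site d)) 0 (z k)) := hstep
      _ ≤ ν.real (⋂ i ∈ Finset.range (k + 1), openConnIn (↑(box d (b (k + 1))) : Set (Site d)) 0 (z i)) :=
          measureReal_mono hsub

/-- **`k` POINTS AT GEOMETRICALLY SEPARATED SCALES BELONG TO KESTEN'S IIC WITH PROBABILITY AT LEAST `c^k ∏ π(‖z_i‖)`** (`p_c(ℤ^d)`, `d ≥ 2`;
(A2)□ at aspect `(s,L)`, `2 ≤ s ≤ L`, `ϰ > 0`; `CU⁺_l(c_U)`, `l ≥ 2`, `c_U > 0`; UAD): there are `v ≥ 1` and `c > 0` such that for every finite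
measure `ν` with Kesten's IIC limit property, every `b₀ ≥ 1`, all sites `z_i` with `z_i ∈ Λ(64·v·b₀ρ^i) ∖ Λ(32·v·b₀ρ^i)` (`ρ = 64 l v`) and
every `k`: **`c^k · ∏_{i<k} π_{p_c}(‖z_i‖_∞) · ν(univ) ≤ ν(⋂_{i<k} {0 ↔ z_i})`** — the lower half of `ν(z_0,…,z_{k−1} ∈ C(0)) ≍ ∏_i π(‖z_i‖)`
across separated scales. [cite: Kesten1986, Thm. (8)] [cite: BasuSapozhnikov2017ECP, Thm. 1.1] -/
theorem exists_prod_oneArmProb_le_iicMeasure_biInter_openConn_criticalProbI (hd : 2 ≤ d) {s L : ℕ} (hs : 2 ≤ s) (hsL : s ≤ L)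
    {ϰ : ℝ} (hϰ : 0 < ϰ) (hA2 : SetToSetQuasiMultAspectAt d (criticalProbI d) s L ϰ) {l : ℕ} (hl : 2 ≤ l) {cU : ℝ} (hcU : 0 < cU)
    (hCU : ∀ a : ℕ, 1 ≤ a → ∀ E : Set (BondConfig (Site d)), IsUpperSet E → MeasurableSet E →
      cU * (bondPercolation (zdGraph d) (criticalProbI d)).real E ≤ (bondPercolation (zdGraph d) (criticalProbI d)).real (E ∩
        {ω : BondConfig (Site d) | ∀ t ∈ innerBoundary (zdGraph d) (box d a), ∀ s ∈ innerBoundary (zdGraph d) (box d (l * a)),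
          ∀ t' ∈ innerBoundary (zdGraph d) (box d a), ∀ s' ∈ innerBoundary (zdGraph d) (box d (l * a)),
          ω ∈ openConnIn (↑((box d (l * a) \ box d a) ∪ innerBoundary (zdGraph d) (box d a)) : Set (Site d)) t s →
          ω ∈ openConnIn (↑((box d (l * a) \ box d a) ∪ innerBoundary (zdGraph d) (box d a)) : Set (Site d)) t' s' →
          ω ∈ openConnIn (↑((box d (l * a) \ box d a) ∪ innerBoundary (zdGraph d) (box d a)) : Set (Site d)) s s'}))
    (hUAD : ∀ ε : ℝ, 0 < ε → ∃ K₀ : ℕ, ∀ m : ℕ, 1 ≤ m → ∀ N : ℕ, K₀ * m ≤ N →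
      (bondPercolation (zdGraph d) (criticalProbI d)).real (boxCrossing d m N) ≤ ε) :
    ∃ (v : ℕ) (c : ℝ), 1 ≤ v ∧ 0 < c ∧ ∀ (ν : Measure (BondConfig (Site d))) [IsFiniteMeasure ν],
      (∀ (F : Finset (Sym2 (Site d))) (E : Set (BondConfig (Site d))), MeasurableSet E → DeterminedBy E ↑F →
        Tendsto (fun n : ℕ => (bondPercolation (zdGraph d) (criticalProbI d)).real (E ∩ siteToBoundary d n) /
          oneArmProb d (criticalProbI d) n) atTop (𝓝 (ν.real E))) →
      ∀ (b₀ : ℕ), 1 ≤ b₀ → ∀ (z : ℕ → Site d),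
        (∀ i, z i ∈ box d (64 * (v * (b₀ * (64 * l * v) ^ i))) \ box d (32 * (v * (b₀ * (64 * l * v) ^ i)))) →
        ∀ k : ℕ, c ^ k * (∏ i ∈ Finset.range k, oneArmProb d (criticalProbI d) (Site.supNorm (z i))) * ν.real Set.univ ≤
          ν.real (⋂ i ∈ Finset.range k, (openConn (0 : Site d) (z i) : Set (BondConfig (Site d)))) := by
  have hd1 : 1 ≤ d := le_trans (by norm_num) hd
  obtain ⟨B, hB, hR2⟩ := Rsw3.exists_oneArmProb_ratio_of_setToSetQuasiMultAspectAt hd hs hsL hϰ hA2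
  have hp : 0 < ((criticalProbI d : unitInterval) : ℝ) := by
    rw [coe_criticalProbI]; exact criticalProb_zd_pos d hd1
  have hπ : ∀ m : ℕ, 0 < oneArmProb d (criticalProbI d) m := fun m => oneArmProb_pos hd1 _ hp m
  have hBl : 0 < B ^ (l + 1) := pow_pos hB _
  have hRl : ∀ j m : ℕ, 1 ≤ j → j ≤ m → m ≤ 4 * (l + 1) * j →
      oneArmProb d (criticalProbI d) j ≤ B ^ (l + 1) * oneArmProb d (criticalProbI d) m := fun j m hj hjm hm =>
    oneArmProb_ratio_iter _ hR2 hπ (l + 1) j m hj hjm (hm.trans (Nat.mul_le_mul_right j (four_mul_succ_le_eight_pow l)))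
  obtain ⟨K₀, hK₀⟩ := hUAD (1 / (2 * B ^ (l + 1))) (by positivity)
  have hεB : 1 / (2 * B ^ (l + 1)) * B ^ (l + 1) ≤ 1 / 2 := le_of_eq (by field_simp)
  have hK : 1 ≤ K₀ + 1 := by omega
  have hKK₀ : K₀ ≤ 16 * s * (K₀ + 1) := by nlinarith
  set v : ℕ := s * (K₀ + 1) with hv
  have hv1 : 1 ≤ v := by rw [hv]; nlinarith
  set c : ℝ := cU / (2 * B ^ (l + 1)) / B with hc
  have hcpos : 0 < c := by positivity
  refine ⟨v, c, hv1, hcpos, fun ν _ hν b₀ hb₀ z hz k => ?_⟩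
  -- the geometric scales
  set b : ℕ → ℕ := fun i => b₀ * (64 * l * v) ^ i with hbdef
  have hb0 : 1 ≤ b 0 := by simp only [hbdef, pow_zero, mul_one]; exact hb₀
  have hb : ∀ i, b (i + 1) = l * (64 * (s * (K₀ + 1) * b i)) := by
    intro i; simp only [hbdef, pow_succ, ← hv]; ring
  have hz' : ∀ i, z i ∈ box d (64 * (s * (K₀ + 1) * b i)) \ box d (32 * (s * (K₀ + 1) * b i)) := by
    intro i; rw [← hv]; exact hz i
  have hA := prod_mul_iicMeasure_le_biInter_openConnIn (criticalProbI d) hl hcU.le hCU hBl hεB hK₀ hRl hν hs hK hKK₀ b hb0 hb z hz' k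
  -- `π(64 v b_i) ≥ π(‖z_i‖)/B` since `‖z_i‖ ≤ 64 v b_i ≤ 2‖z_i‖`
  have hfac : ∀ i, c * oneArmProb d (criticalProbI d) (Site.supNorm (z i)) ≤
      cU / (2 * B ^ (l + 1)) * oneArmProb d (criticalProbI d) (64 * (s * (K₀ + 1) * b i)) := by
    intro i
    have hzi := hz' i
    rw [Finset.mem_sdiff, mem_box_iff_supNorm_le, mem_box_iff_supNorm_le] at hzi
    have hj1 : 1 ≤ Site.supNorm (z i) := by
      have : 1 ≤ s * (K₀ + 1) * b i := by rw [← hv]; exact Nat.one_le_iff_ne_zero.2 (by positivity)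
      omega
    have hratio := hR2 (Site.supNorm (z i)) (64 * (s * (K₀ + 1) * b i)) hj1 hzi.1 (by omega)
    rw [hc, div_mul_eq_mul_div, div_le_iff₀ hB]
    calc cU / (2 * B ^ (l + 1)) * oneArmProb d (criticalProbI d) (Site.supNorm (z i))
        ≤ cU / (2 * B ^ (l + 1)) * (B * oneArmProb d (criticalProbI d) (64 * (s * (K₀ + 1) * b i))) :=
          mul_le_mul_of_nonneg_left hratio (by positivity)
      _ = cU / (2 * B ^ (l + 1)) * oneArmProb d (criticalProbI d) (64 * (s * (K₀ + 1) * b i)) * B := by ring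
  have hprod : c ^ k * ∏ i ∈ Finset.range k, oneArmProb d (criticalProbI d) (Site.supNorm (z i)) ≤
      ∏ i ∈ Finset.range k, cU / (2 * B ^ (l + 1)) * oneArmProb d (criticalProbI d) (64 * (s * (K₀ + 1) * b i)) := by
    rw [← Finset.card_range k, ← Finset.prod_const, Finset.card_range, ← Finset.prod_mul_distrib]
    exact Finset.prod_le_prod (fun i _ => mul_nonneg hcpos.le (hπ _).le) fun i _ => hfac i
  have hglob : ν.real (⋂ i ∈ Finset.range k, openConnIn (↑(box d (b k)) : Set (Site d)) 0 (z i)) ≤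
      ν.real (⋂ i ∈ Finset.range k, (openConn (0 : Site d) (z i) : Set (BondConfig (Site d)))) :=
    measureReal_mono (Set.biInter_mono (fun i hi => hi) fun i _ ω hω => DCT16.reachable_of_pathIn (pathIn_of_mem_openConnIn hω))
  calc c ^ k * (∏ i ∈ Finset.range k, oneArmProb d (criticalProbI d) (Site.supNorm (z i))) * ν.real Set.univ
      ≤ (∏ i ∈ Finset.range k, cU / (2 * B ^ (l + 1)) * oneArmProb d (criticalProbI d) (64 * (s * (K₀ + 1) * b i))) *
          ν.real Set.univ := mul_le_mul_of_nonneg_right hprod measureReal_nonneg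
    _ ≤ ν.real (⋂ i ∈ Finset.range k, openConnIn (↑(box d (b k)) : Set (Site d)) 0 (z i)) := hA
    _ ≤ ν.real (⋂ i ∈ Finset.range k, (openConn (0 : Site d) (z i) : Set (BondConfig (Site d)))) := hglob

end Summit.CriticalPhenomena.PercolationContinuityZ3.Theorems.Crossing

end
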